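import Mathlib
import HarnessLib
import Literature.Geometry.DiscreteGeometry.ConvexHullFacets
import Summits.AtomisticToContinuum.Crystallization.Theorems.PricedLinkCensusSoftFourRingsThreeTriQuad
import Summits.AtomisticToContinuum.Crystallization.Theorems.PricedLinkCensusSoftFourRingsFacetCap

/-!
# Facets of the hull of the twelve link directions are triangles or quadrilaterals

Route `PricedLinkCensus`, item `SoftFourRings` (stmt-AtomisticToContinuum-14234), evidence
`softrings-search.md` §12.  Five points of `X` cannot be tight for one supporting functional `c`
(`⟪c, ·⟫ ≤ 1` on `X`, `= 1` at the five): they would be cocircular on the circle of angular radius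
`R`, `cos² R = 1/‖c‖²`, and pairwise `≥ 59.35°` apart, so their azimuths about the axis would be
pairwise `≥ arccos μ` apart with `μ = (ca − cos² R)/(1 − cos² R)`; under Tammes-13 (`FacetCap`:
`cos² R > 0.2938`) `μ < 0.306 < cos 72°`, and five azimuths pairwise more than `72°` apart do not fit
on a circle.  Hence every tight set — in particular every facet of `conv X` and its vertex count `m_f`
in Legendre's identity `Σ_f m_f = 2#X + 2#facets − 4` — has at most four points
(`card_tightSet_le_four_of_twelve_le_card`, CONDITIONAL on `musinTarasov2012_tammes_thirteen`), so the
hull of the twelve directions consists of triangles and at most six quadrilaterals.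

Contents: `five_sorted_false` / `five_circle_false` (circle), `tight_five_false` (sphere, general
constants), `card_tightSet_le_four_of_twelve_le_card` (the `η = 1/100` window with Tammes-13).
-/

namespace Summit.AtomisticToContinuum.Crystallization.Theorems

open Real RealInnerProductSpace Literature.Geometry.DiscreteGeometry

/-- **Five sorted angles pairwise more than `2π/5` apart do not fit in `(−π, π]`.** [folklore] -/
theorem five_sorted_false {g : ℝ} (hg : 2 * π / 5 < g) (hgπ : g ≤ π) (t : Fin 5 → ℝ)
    (hmono : StrictMono t) (hlo : -π < t 0) (hhi : t 4 ≤ π)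
    (hsep : ∀ i j, i ≠ j → cos (t i - t j) ≤ cos g) : False := by
  have hπ := pi_pos
  have h01 : t 0 < t 1 := hmono (by decide)
  have h12 : t 1 < t 2 := hmono (by decide)
  have h23 : t 2 < t 3 := hmono (by decide)
  have h34 : t 3 < t 4 := hmono (by decide)
  have key : ∀ x : ℝ, 0 < x → x < 2 * π → cos x ≤ cos g → g ≤ x ∧ x ≤ 2 * π - g := by
    intro x hx0 hx2 hc
    rcases le_or_gt x π with hxπ | hxπ
    · exact ⟨le_of_cos_le_cos hx0.le hgπ hc, by linarith⟩
    · have hc' : cos (2 * π - x) ≤ cos g := by rwa [cos_two_pi_sub]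
      have := le_of_cos_le_cos (by linarith) hgπ hc'
      exact ⟨by linarith, by linarith⟩
  obtain ⟨g1, -⟩ := key (t 1 - t 0) (by linarith) (by linarith) (hsep 1 0 (by decide))
  obtain ⟨g2, -⟩ := key (t 2 - t 1) (by linarith) (by linarith) (hsep 2 1 (by decide))
  obtain ⟨g3, -⟩ := key (t 3 - t 2) (by linarith) (by linarith) (hsep 3 2 (by decide))
  obtain ⟨g4, -⟩ := key (t 4 - t 3) (by linarith) (by linarith) (hsep 4 3 (by decide))
  obtain ⟨-, g40⟩ := key (t 4 - t 0) (by linarith) (by linarith) (hsep 4 0 (by decide))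
  linarith

/-- **Five angles in `(−π, π]` cannot be pairwise more than `2π/5` apart** (circularly:
`cos (θ i − θ j) ≤ cos g` with `2π/5 < g ≤ π`). [folklore] -/
theorem five_circle_false {g : ℝ} (hg : 2 * π / 5 < g) (hgπ : g ≤ π) (θ : Fin 5 → ℝ)
    (hθ : ∀ k, -π < θ k ∧ θ k ≤ π) (hsep : ∀ i j, i ≠ j → cos (θ i - θ j) ≤ cos g) : False := by
  have hπ := pi_pos
  have hcos1 : cos g < 1 := by
    have := cos_lt_cos_of_nonneg_of_le_pi (le_refl 0) hgπ (by linarith : (0 : ℝ) < g)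
    rwa [cos_zero] at this
  have hθinj : Function.Injective θ := by
    intro i j hij
    by_contra hne
    have := hsep i j hne
    rw [hij, sub_self, cos_zero] at this
    linarith
  have hAcard : (Finset.univ.image θ).card = 5 := by
    rw [Finset.card_image_of_injective _ hθinj, Finset.card_univ, Fintype.card_fin]
  let e := (Finset.univ.image θ).orderEmbOfFin hAcard
  have hmem' : ∀ k, ∃ i, θ i = e k := by
    intro k
    have := (Finset.univ.image θ).orderEmbOfFin_mem hAcard k
    rw [Finset.mem_image] at this
    obtain ⟨i, -, hi⟩ := this
    exact ⟨i, hi⟩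
  refine five_sorted_false hg hgπ (fun k => e k) e.strictMono ?_ ?_ ?_
  · obtain ⟨i, hi⟩ := hmem' 0
    show -π < e 0
    rw [← hi]; exact (hθ i).1
  · obtain ⟨i, hi⟩ := hmem' 4
    show e 4 ≤ π
    rw [← hi]; exact (hθ i).2
  · intro a b hab
    obtain ⟨i, hi⟩ := hmem' a
    obtain ⟨j, hj⟩ := hmem' b
    have hne : i ≠ j := by
      rintro rfl
      exact hab (e.injective (hi.symm.trans hj))
    show cos (e a - e b) ≤ cos g
    rw [← hi, ← hj]
    exact hsep i j hne

/-- **Five cocircular separated unit vectors do not exist on a small circle** (general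
constants).  Let `ca < 1`, `−1 ≤ μ < cos (2π/5)`.  If five unit vectors `y i` of `ℝ³` are tight
for one functional (`⟪c, y i⟫ = 1`), pairwise at inner product `≤ ca`, and the circle is small in
the sense `ca − μ ≤ (1 − μ)/‖c‖²` (i.e. `(ca − cos² R)/(1 − cos² R) ≤ μ` for `cos² R = 1/‖c‖²`),
contradiction. [folklore] -/
theorem tight_five_false {ca μ : ℝ} (hca1 : ca < 1) (hμ1 : -1 ≤ μ) (hμ : μ < cos (2 * π / 5))
    {c : EuclideanSpace ℝ (Fin 3)} (y : Fin 5 → EuclideanSpace ℝ (Fin 3)) (hy : ∀ i, ‖y i‖ = 1)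
    (hcy : ∀ i, ⟪c, y i⟫ = 1) (hsep : ∀ i j, i ≠ j → ⟪y i, y j⟫ ≤ ca)
    (hsmall : ca - μ ≤ (1 - μ) / ‖c‖ ^ 2) : False := by
  have hπ := pi_pos
  have hc0 : c ≠ 0 := by
    intro h
    have := hcy 0
    rw [h, inner_zero_left] at this
    exact zero_ne_one this
  have hcn : 0 < ‖c‖ := norm_pos_iff.2 hc0
  -- `‖c‖ > 1`: otherwise all `y i` coincide with `c/‖c‖`
  have hc1 : 1 < ‖c‖ := by
    by_contra hle
    push Not at hle
    have heq : ∀ i, y i = c := by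
      intro i
      have h1 : ⟪c, y i⟫ ≤ ‖c‖ * ‖y i‖ := real_inner_le_norm c (y i)
      rw [hcy i, hy i, mul_one] at h1
      have hc1' : ‖c‖ = 1 := le_antisymm hle h1
      have : ‖c - y i‖ ^ 2 = 0 := by
        rw [← real_inner_self_eq_norm_sq, inner_sub_left, inner_sub_right, inner_sub_right,
          real_inner_self_eq_norm_sq, real_inner_self_eq_norm_sq, hc1', hy i,
          real_inner_comm c (y i), hcy i]
        norm_num
      have : c - y i = 0 := by
        rwa [sq_eq_zero_iff, norm_eq_zero] at this
      exact (sub_eq_zero.1 this).symm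
    have h01 := hsep 0 1 (by decide)
    rw [heq 0, heq 1, real_inner_self_eq_norm_sq] at h01
    have hn1 : ‖c‖ ^ 2 = 1 := by
      have h := hcy 0
      rw [heq 0, real_inner_self_eq_norm_sq] at h
      exact h
    linarith
  -- the axis `v = c/‖c‖`, the level `s = 1/‖c‖`, tangent frame
  set v : EuclideanSpace ℝ (Fin 3) := ‖c‖⁻¹ • c with hv
  have hv1 : ‖v‖ = 1 := by rw [hv, norm_smul, norm_inv, norm_norm, inv_mul_cancel₀ hcn.ne']
  have hvy : ∀ i, ⟪v, y i⟫ = ‖c‖⁻¹ := fun i => by rw [hv, real_inner_smul_left, hcy i, mul_one]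
  obtain ⟨ρ, θ, hρ0, hρsq, hθ, hinner⟩ := tangent_polar hv1 y hy
  set a : ℝ := ‖c‖⁻¹ ^ 2 with ha
  have ha1 : a < 1 := by
    rw [ha, inv_pow]; exact inv_lt_one_of_one_lt₀ (by nlinarith)
  have ha0 : 0 < a := by rw [ha]; positivity
  have hρa : ∀ i, ρ i ^ 2 = 1 - a := fun i => by rw [hρsq, hvy]
  have hρρ : ∀ i j, ρ i * ρ j = 1 - a := by
    intro i j
    have h2 : (ρ i * ρ j) ^ 2 = (1 - a) ^ 2 := by rw [mul_pow, hρa, hρa, sq]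
    have := (pow_left_inj₀ (mul_nonneg (hρ0 i) (hρ0 j)) (by linarith) two_ne_zero).1 h2
    exact this
  -- azimuth separation `cos (θ i - θ j) ≤ μ`
  have hsmall' : ca - a ≤ μ * (1 - a) := by
    have : (1 - μ) / ‖c‖ ^ 2 = (1 - μ) * a := by rw [ha, inv_pow, div_eq_mul_inv]
    rw [this] at hsmall
    linarith
  have hsepθ : ∀ i j, i ≠ j → cos (θ i - θ j) ≤ μ := by
    intro i j hij
    have h := hsep i j hij
    rw [hinner, hρρ, hvy, hvy] at h
    have h' : (1 - a) * cos (θ i - θ j) ≤ ca - a := by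
      have : ‖c‖⁻¹ * ‖c‖⁻¹ = a := by rw [ha, sq]
      linarith [this]
    by_contra hlt
    push Not at hlt
    have : μ * (1 - a) < (1 - a) * cos (θ i - θ j) := by nlinarith
    linarith
  -- the angle `g = arccos μ > 2π/5`
  set g := arccos μ with hg
  have hμ1' : μ ≤ 1 := by linarith [cos_le_one (2 * π / 5)]
  have hcg : cos g = μ := cos_arccos hμ1 hμ1'
  have h25 : 2 * π / 5 < g := by
    have h1 : arccos (cos (2 * π / 5)) = 2 * π / 5 :=
      arccos_cos (by linarith) (by linarith)
    rw [hg, ← h1]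
    exact arccos_lt_arccos hμ1 hμ (cos_le_one _)
  exact five_circle_false h25 (arccos_le_pi μ) θ hθ (fun i j hij => by rw [hcg]; exact hsepθ i j hij)

/-- **Every facet (indeed every tight set) of the twelve link directions has at most four points**
(conditional on Tammes-13).  For at least twelve unit vectors pairwise at inner product
`≤ ca = 1 − 1/(2·(101/100)²)` (angle `≥ 59.35°`, so chord `≥ 0.99 ≥ 0.957`) and any functional with
`⟪c, ·⟫ ≤ 1` on `X`: `#(tightSet X c) ≤ 4`.  With `FacetCap`: `1/‖c‖² > ((2 − 0.957²)/2)² ≈ 0.2938`,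
so `μ = (ca − 0.2938…)/(1 − 0.2938…) ≈ 0.3059 < cos 72° ≈ 0.3090`.
[cite: MusinTarasov2012, Theorem 1] -/
theorem card_tightSet_le_four_of_twelve_le_card (hT : musinTarasov2012_tammes_thirteen)
    {X : Finset (EuclideanSpace ℝ (Fin 3))} (hX1 : ∀ y ∈ X, ‖y‖ = 1) (hcard : 12 ≤ X.card)
    (hsep : ∀ u ∈ X, ∀ v ∈ X, u ≠ v → ⟪u, v⟫ ≤ 1 - 1 / (2 * (101 / 100 : ℝ) ^ 2))
    {c : EuclideanSpace ℝ (Fin 3)} (hc : ∀ y ∈ X, ⟪c, y⟫ ≤ 1) : (tightSet X c).card ≤ 4 := by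
  classical
  by_contra h5
  push Not at h5
  -- chordal separation and the Tammes bound on `‖c‖`
  have hdist : ∀ u ∈ X, ∀ v ∈ X, u ≠ v → (0.957 : ℝ) ≤ dist u v := by
    intro u hu v hv huv
    have hd : dist u v ^ 2 = 2 - 2 * ⟪u, v⟫ := by
      rw [dist_eq_norm, ← real_inner_self_eq_norm_sq, inner_sub_left, inner_sub_right,
        inner_sub_right, real_inner_self_eq_norm_sq, real_inner_self_eq_norm_sq, hX1 u hu,
        hX1 v hv, real_inner_comm u v]
      ring
    have h2 : (0.957 : ℝ) ^ 2 ≤ dist u v ^ 2 := by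
      rw [hd]; have := hsep u hu v hv huv; norm_num at this ⊢; linarith
    exact (pow_le_pow_iff_left₀ (by norm_num) dist_nonneg two_ne_zero).1 h2
  have hnorm := norm_lt_of_forall_inner_le_one hT hX1 hcard hdist hc
  -- five tight points
  obtain ⟨t, ht, ht5⟩ := Finset.exists_subset_card_eq (show 5 ≤ (tightSet X c).card by omega)
  have htc : Fintype.card t = 5 := by rw [Fintype.card_coe]; exact ht5
  set e := Fintype.equivFinOfCardEq htc with he
  set y : Fin 5 → EuclideanSpace ℝ (Fin 3) := fun i => ((e.symm i : t) : EuclideanSpace ℝ (Fin 3))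
    with hy
  have hyt : ∀ i, y i ∈ tightSet X c := fun i => ht (e.symm i).2
  have hyX : ∀ i, y i ∈ X := fun i => (mem_tightSet.1 (hyt i)).1
  have hcy : ∀ i, ⟪c, y i⟫ = 1 := fun i => (mem_tightSet.1 (hyt i)).2
  have hyinj : Function.Injective y := by
    intro i j hij
    have : e.symm i = e.symm j := Subtype.ext hij
    exact e.symm.injective this
  have hcn : 0 < ‖c‖ := by
    by_contra h0
    push Not at h0
    have hc0 : c = 0 := norm_le_zero_iff.1 h0
    have h1 := hcy 0
    rw [hc0, inner_zero_left] at h1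
    exact zero_ne_one h1
  refine tight_five_false (ca := 1 - 1 / (2 * (101 / 100 : ℝ) ^ 2))
    (μ := (1 - 1 / (2 * (101 / 100 : ℝ) ^ 2) - ((2 - 0.957 ^ 2) / 2) ^ 2) /
      (1 - ((2 - 0.957 ^ 2) / 2) ^ 2))
    (by norm_num) (by norm_num) ?_ y (fun i => hX1 _ (hyX i)) hcy
    (fun i j hij => hsep _ (hyX i) _ (hyX j) (fun h => hij (hyinj h))) ?_
  · -- `μ < cos (2π/5) = (√5 − 1)/4`
    rw [cos_two_pi_div_five]
    have h5 : (2.236 : ℝ) < Real.sqrt 5 := by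
      rw [show (2.236 : ℝ) = Real.sqrt (2.236 ^ 2) by rw [Real.sqrt_sq]; norm_num]
      exact Real.sqrt_lt_sqrt (by norm_num) (by norm_num)
    norm_num at h5 ⊢
    linarith
  · -- smallness: `ca − μ ≤ (1 − μ)/‖c‖²` from `‖c‖ < 2/(2 − 0.957²)`
    have hK : ‖c‖ ^ 2 < (2 / (2 - 0.957 ^ 2)) ^ 2 := pow_lt_pow_left₀ hnorm hcn.le two_ne_zero
    have hc2 : 0 < ‖c‖ ^ 2 := by positivity
    rw [le_div_iff₀ hc2]
    norm_num at hK ⊢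
    nlinarith [hK, hc2]

end Summit.AtomisticToContinuum.Crystallization.Theorems
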